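import Literature.MathematicalPhysics.QuantumFieldTheory.Balaban1983to89.B12Eq210Scaling
import Literature.MathematicalPhysics.QuantumFieldTheory.Balaban1983to89.B12Eq15DictionaryInstance
import Literature.MathematicalPhysics.QuantumFieldTheory.Balaban1983to89.B12Eq213Body268

/-!
# `Balaban1983to89.B12Eq211Operator267` — T. Bałaban, *Renormalization group approach to lattice gauge field
theories. I*, Commun. Math. Phys. **109** (1987) 249–301 [Balaban1987RG1], p. 267 after display (2.11): «The quadratic
form in B′ above is equal to −½⟨B′, Δ^{(k)}B′⟩, see the definition (3.156) [13] with the δ-function gauge fixing term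
replaced by the exponential one. This quadratic form defines the k-th normalization factor Z^{(k)}(U_{k+1}) given by
the formula (1.4) with j = k. The quadratic form defines also a Gaussian measure. … we have B′ = CB … with the
covariance C^{(k)} = C^{(k)}(U_{k+1}) = (C*Δ^{(k)}C)⁻¹» — THE OPERATOR `Δ^{(k)}` OF (2.11) AS ONE SYMMETRIC MATRIX
`Δ_k + G₂` AT THE [13] DICTIONARY (`Δ_k` := (3.156) [13] = `B10Eq54QuadForm.deltaK`, `G₂` = the Hessian of the
exponential gauge fixing (2.5)), ITS UNIQUENESS, p07's display `terms211` = (2.11) `= −½⟨B′, (Δ_k + G₂)B′⟩` on r07's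
assembled instance `dataB9`, AND THE TWO PLACES WHERE PRINT CONSUMES `Δ^{(k)}` FED BY NAME: (1.4) with `j = k`
(p07's `Z14`) and the Gaussian measure of p. 268 with covariance `(C*Δ^{(k)}C)⁻¹` (r20's `prec212` ∕ `covariance_gaussProb`)

statement-level skeleton of published theorems with citation tags; proofs where landed; nothing here is a claim about
the Yang–Mills mass gap

SOURCES (all HELD).  [B12] = `paper:balaban1987-cmp109-rg-i-small-field` p. 267 [PDF 19] (text layer `p0019.txt` L35–41,
re-read 2026-08-23 by this seat; render `b2b-balaban-ref1/pages/1987-cmp109-rg-I-small-field/…-p019-x2.png`):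
«Terms of the order 0 in g_k are ⟨H₁hC̃^{(2)}(B′), J⟩ − ½G^{(2)}(B′) − ½⟨H₁B′, Δ₁H₁B′⟩. (2.11) The quadratic form in
B′ above is equal to −½⟨B′, Δ^{(k)}B′⟩, see the definition (3.156) [13] with the δ-function gauge fixing term
replaced by the exponential one. This quadratic form defines the k-th normalization factor Z^{(k)}(U_{k+1}) given by
the formula (1.4) with j = k. The quadratic form defines also a Gaussian measure.»; p. 268 [PDF 20] L1–4: «δ(Q̃B′) we
eliminate the variables B′(b₀(c)), c ∈ T₁^{(k+1)}. Denoting the remaining variables by B we have B′ = CB, C is the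
operator determined by the configuration V^{(k)}, and the measure becomes a Gaussian measure in variables B, with
the covariance C^{(k)} = C^{(k)}(U_{k+1}) = (C*Δ^{(k)}C)⁻¹.»  [13] = [Balaban1985BackgroundPropagators] (CMP 99)
p. 428 (3.156) «⟨B, (QG₁Q*)⁻¹B⟩ − a⟨B, B⟩ − 2⟨H₁D̃⁽²⁾(B), J⟩ = ⟨B, Δ_kB⟩» (quoted in `B10Eq54QuadForm`); p. 427 (3.155)
(the δ-function gauge fixing `δ_{Ax}(B)` of the `B`-integration).

CITATION HEADER ∕ WHAT IS REPRODUCED.  SKELETON row **B12.Eq2.11** (kind C∕D; display owner r09 = this seat,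
`lit-balaban-r09/ROWS-B12.md`; head `typed-existing` through v2.183).  WHAT THE TREE HAD (used BY NAME, nothing
re-derived or restated): p07's `B12Eq15QuadraticForm` ((1.5) record `Data`, `Data.quad` = `⟨B, Δ^{(j)}(U_k)B⟩` DEFINED
by (1.5), `Z14` = (1.4), `Z14_form`) and `B12Eq210Scaling` (the display (2.11) WITH BODY `terms211`,
`terms211_eq_neg_half_quad`, `Setting.bracket210_onConstraint_quad` = «terms of the order 0 in g_k are (2.11)»
PROVED); r07's `B10Eq54QuadForm` (`deltaK` = THE DEFINITION (3.156), `deltaK_transpose`, `G1inv_transpose`) and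
`B12Eq15DictionaryInstance` (p357842: the (1.5) datum ASSEMBLED on the [13] Sect. D dictionary `dataB9` — `H₁ :=
h1Op` (3.127)∕(3.129), `Δ₁ :=` a bond operator with the [7] (79) slice form —, the `J`-matrix `jMatrix` = [13]'s `E`,
and THE p. 267 SENTENCE `dataB9_quad_eq_deltaK[_of_Δa]`: `⟨B, Δ^{(k)}B⟩ = ⟨B, Δ_kB⟩ + G^{(2)}(B)`; `dataB9_eq211`);
r20's `B12Eq213Body268` v1.2 §4 (`prec212 C Δ = CᵀΔC`, `quadForm_prec212` = «B′ = CB» in the form,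
`covariance_gaussProb`: the coordinates under the tree's normalised Gaussian `gaussProb M` have covariance `M⁻¹`).
THIS FILE adds what ties them into ONE operator and feeds it to the consumers — nothing below is in those files.

WHAT THIS FILE PROVES (one matrix abbreviation with body + theorems; 0 `Prop` facts, 0 sorry; axioms standard).
* §1 **`gMat dat`** — the matrix of the polar form `G₂` of `G^{(2)}` (the Hessian of the exponential gauge fixing
  (2.5): «with the δ-function gauge fixing term replaced by the exponential one») for ANY (1.5) datum on `ℝ^q`;
  `gMat_form`, `Gtwo_eq_gMat_quadForm` (`G^{(2)}(B) = ⟨B, G₂B⟩`), `gMat_transpose`.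
* §2 **`Δ^{(k)} = Δ_k + G₂` ON r07's ASSEMBLED INSTANCE**: `dataB9_quad_eq_deltaK_add_gMat[_of_Δa]`
  (`⟨B, Δ^{(k)}B⟩ = ⟨B, (Δ_k + G₂)B⟩`, r07's `dataB9_quad_eq_deltaK` regrouped into one matrix) and
  **`terms211_dataB9[_of_Δa]`** — p07's DISPLAY (2.11) `terms211` evaluated on the instance:
  `⟨H₁hC̃^{(2)}(B′), J⟩ − ½G^{(2)}(B′) − ½⟨H₁B′, Δ₁H₁B′⟩ = −½⟨B′, (Δ_k + G₂)B′⟩`; and the p. 267 bookkeeping chain at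
  the dictionary, `bracket210_onConstraint_deltaK_add_gMat`: for any (2.10) setting whose (1.5) datum has the form
  `⟨B, (Δ_k + G₂)B⟩` (e.g. `dataB9`), on the constraint surface the bracket of (2.10) after `B′ = B − hD̃(B)`,
  `B = g_kB′` is `−g_k⁻²A(U_{k+1}) − ½⟨B′, (Δ_k + G₂)B′⟩ + g_k·rest + E_k(…)` (p07's `bracket210_onConstraint_quad`).
* §3 **UNIQUENESS — `Δ^{(k)}` IS ONE OPERATOR**: `deltaK_add_gMat_transpose` (symmetric for `K`, `C`, the site
  Laplacian and `G₂` symmetric) and **`eq_deltaK_add_gMat_of_isSymm`**: every SYMMETRIC matrix representing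
  `⟨B, Δ^{(k)}B⟩` on the instance equals `Δ_k + G₂` (polarization) — print's «−½⟨B′, Δ^{(k)}B′⟩» names the
  (3.156)-operator plus the gauge-fixing Hessian and nothing else (cf. r07's `deltaK_eq_of_quadForm54` for (54)).
* §4 **WHERE PRINT CONSUMES `Δ^{(k)}`**: «defines the k-th normalization factor Z^{(k)}(U_{k+1}) … (1.4) with j = k» —
  `Z14_congr`, `Z14_form_eq_of_quad`, **`Z14_form_dataB9_eq`** (`Z14 (matrix of Δ^{(k)}) N = Z14 (Δ_k + G₂) N` for the
  instance); «B′ = CB … the covariance C^{(k)} = (C*Δ^{(k)}C)⁻¹» — **`quadForm_prec212_eq_quad_dataB9`** (r20's precision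
  `prec212 C (Δ_k + G₂)` has the form `⟨CB, Δ^{(k)}(CB)⟩ = ⟨B′, Δ^{(k)}B′⟩` at `B′ = CB` for the instance) and
  **`covariance_gaussProb_prec212`** (under `gaussProb (prec212 C Δk)` the coordinates of `B` have covariance
  `(CᵀΔk C)⁻¹` — print's `C^{(k)}` at `Δk = Δ_k + G₂`).

HONEST SCOPE.  (i) Finite-dimensional linear algebra at a FIXED background: `H₁`, `Δ₁`, `G₁`, `Δ_k` are the cell's
[13]-dictionary MATRICES (`B10Eq54QuadForm` ∕ `B12Eq15DictionaryInstance` HONEST SCOPE (i) verbatim), not operators as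
functions of `U_{k+1}`; the carriers `ℝ^q`, `ℝ^b` are index types, not identified with the bond sets of
`T^{(k)} → T^{(k+1)}`; `h`, `C̃^{(2)}`, `J`, `G^{(2)}` are the free letters of `dataB9` (their B12 constructions live in
`B12HOperator267`, `B12SecondOrder267Concrete`, `B12Eq18Current`, `B12GaugeFixExpansion25` on other carriers, NOT
transported here).  (ii) «with the δ-function gauge fixing term replaced by the exponential one» is READ as in
`B12Eq15DictionaryInstance`: the form (3.156) unchanged, the axial `δ_{Ax}(B)` of (3.155) absent from (2.10), the
Hessian `G^{(2)}` of (2.5) added — which is what (1.5) p. 261 prints.  (iii) No positivity `Δ^{(k)} ≥ γ₀` (the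
precision's positive definiteness is a HYPOTHESIS `hpd` in §4; that is [13] Sect. E ∕ `B9SectEKernel`), no locality,
no bound.  (iv) The elimination map `C` (`Cop`) and the kernel parametrisation `N` of (1.4) are parameters (B12
constructions: `Beta.ConstraintElimination.elim`, `B12B0Restriction267`).  Located bookkeeping for one skeleton row;
NOT summit progress (not continuum, not Clay).  Unit `lit-balaban-r09` gen 44 (free-target protocol G.5-34(d)), HOME
`run/shared/lean/pub/lit-balaban/`.
-/

namespace Literature.MathematicalPhysics.QuantumFieldTheory.Balaban1983to89.B12Eq211Operator267

noncomputable section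

open Matrix
open scoped Matrix
open B12Eq15QuadraticForm (Data Z14)
open B12Eq210Scaling (terms211 terms211_eq_neg_half_quad)
open B12Eq15DictionaryInstance (jMatrix dataB9 dataB9_quad_eq_deltaK dataB9_quad_eq_deltaK_of_Δa)
open B10Eq54QuadForm (delta1 deltaK_transpose G1inv_transpose)
open Literature.MathematicalPhysics.QuantumFieldTheory.Balaban1983to89.Beta.Composition (kkt)
open B9Eq3112 (dcon)
open B9Eq3152 (G1inv)

/-! ## §1  The Hessian of the exponential gauge fixing as a matrix: `G₂ = gMat` -/

section GMat

variable {q : Type*} [Fintype q] [DecidableEq q] {W X : Type*} [AddCommGroup W] [Module ℝ W] [AddCommGroup X]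
  [Module ℝ X]

/-- **The Hessian of the exponential gauge fixing**: the matrix of the polar form `G₂` of `G^{(2)}` ((2.5): `G(B′) =
½G^{(2)}(B′) + G₃(B′)`) of a (1.5) datum on `ℝ^q` — «the δ-function gauge fixing term replaced by the exponential one».
[cite: Balaban1987RG1, (2.5) p.266, (2.11) p.267] -/
def gMat (dat : Data ℝ (q → ℝ) W X) : Matrix q q ℝ :=
  LinearMap.toMatrix₂' ℝ dat.G₂

variable (dat : Data ℝ (q → ℝ) W X)

/-- `B₁ ⬝ᵥ G₂ *ᵥ B₂ = G₂(B₁, B₂)`. [cite: Balaban1987RG1, (2.5) p.266] -/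
theorem gMat_form (B₁ B₂ : q → ℝ) : B₁ ⬝ᵥ gMat dat *ᵥ B₂ = dat.G₂ B₁ B₂ := by
  rw [← Matrix.toLinearMap₂'_apply', gMat, Matrix.toLinearMap₂'_toMatrix']

/-- `G^{(2)}(B) = ⟨B, G₂B⟩`. [cite: Balaban1987RG1, (2.5) p.266] -/
theorem Gtwo_eq_gMat_quadForm (B : q → ℝ) : dat.Gtwo B = B ⬝ᵥ gMat dat *ᵥ B := by
  rw [gMat_form]
  rfl

/-- The entries of `gMat`. [cite: Balaban1987RG1, (2.5) p.266] -/
theorem gMat_entry (i j : q) : gMat dat i j = dat.G₂ (Pi.single i 1) (Pi.single j 1) := by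
  rw [gMat, LinearMap.toMatrix₂'_apply]

/-- `G₂` symmetric (a polar form) ⇒ its matrix is symmetric. [cite: Balaban1987RG1, (2.5) p.266] -/
theorem gMat_transpose (hG : ∀ x y, dat.G₂ x y = dat.G₂ y x) : (gMat dat)ᵀ = gMat dat := by
  ext i j
  rw [transpose_apply, gMat_entry, gMat_entry, hG]

end GMat

/-! ## §2  `Δ^{(k)} = Δ_k + G₂` on r07's assembled instance, and the display (2.11) `terms211` there -/

section Instance

variable {n m τ b q σ : Type*} [Fintype n] [Fintype m] [Fintype τ] [Fintype b] [Fintype q] [DecidableEq n]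
  [DecidableEq m] [DecidableEq τ] [DecidableEq b] [DecidableEq q] {X : Type*} [AddCommGroup X] [Module ℝ X]

/-- **`⟨B, Δ^{(k)}B⟩ = ⟨B, (Δ_k + G₂)B⟩` ON THE ASSEMBLED INSTANCE** — r07's `dataB9_quad_eq_deltaK` (`= ⟨B, Δ_kB⟩ +
G^{(2)}(B)`, `Δ_k` := (3.156) [13] at `E = jMatrix`) with the gauge-fixing Hessian put into the matrix: the operator
`Δ^{(k)}` of (2.11)∕(1.5) as ONE matrix.  Hypotheses = those of `B10Eq54QuadForm.eq54_of79`.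
[cite: Balaban1987RG1, (2.11) p.267, (1.5) p.261] [cite: Balaban1985BackgroundPropagators, (3.156) p.428] -/
theorem dataB9_quad_eq_deltaK_add_gMat (e : n ≃ τ ⊕ m) (K C : Matrix b b ℝ) (Δ : Matrix n n ℝ) (Q : Matrix m n ℝ)
    (a : ℝ) (hΔ : Δ.IsSymm) (hΔ' : IsUnit (B9H163.Δ' Δ Q a)) (N : Matrix n τ ℝ) (hQN : Q * N = 0)
    (hQM : IsUnit (Q * Qᵀ).det) (hTs : IsUnit (Nᵀ * (Δ * Δ) * N).det) (D : Matrix b n ℝ) (hD : Dᵀ * D = Δ)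
    (Qb : Matrix q b ℝ) (Dbar : Matrix q m ℝ) (h115 : Qb * D = Dbar * Q) (ab : ℝ)
    (hW : IsUnit (kkt (K - (2 : ℝ) • C) (dcon Δ N D Qb)).det) (hG : IsUnit (G1inv K C Δ Q a D Qb ab).det)
    (hP : IsUnit (Qb * (G1inv K C Δ Q a D Qb ab)⁻¹ * Qbᵀ).det) (Δ1 : Matrix b b ℝ)
    (h79 : ∀ A' : b → ℝ, B9H163.R Δ Q a *ᵥ (Dᵀ *ᵥ A') = 0 →
      A' ⬝ᵥ Δ1 *ᵥ A' = A' ⬝ᵥ K *ᵥ A' - 2 * (A' ⬝ᵥ C *ᵥ A'))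
    (hop : X →ₗ[ℝ] (q → ℝ)) (C₂ : (q → ℝ) →ₗ[ℝ] (q → ℝ) →ₗ[ℝ] X) (pairJ : (b → ℝ) →ₗ[ℝ] ℝ)
    (G₂ : (q → ℝ) →ₗ[ℝ] (q → ℝ) →ₗ[ℝ] ℝ) (B : q → ℝ) :
    (dataB9 K C Δ N D Qb Δ1 hop C₂ pairJ G₂).quad B =
      B ⬝ᵥ (B10Eq54QuadForm.deltaK K C Δ Q a D Qb ab (jMatrix (dataB9 K C Δ N D Qb Δ1 hop C₂ pairJ G₂))
        + gMat (dataB9 K C Δ N D Qb Δ1 hop C₂ pairJ G₂)) *ᵥ B := by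
  rw [dataB9_quad_eq_deltaK e K C Δ Q a hΔ hΔ' N hQN hQM hTs D hD Qb Dbar h115 ab hW hG hP Δ1 h79, add_mulVec,
    dotProduct_add, gMat_form]
  rfl

/-- The same FROM [13]'s POSITIVITY INPUT `Δ_a > 0` ALONE (r07's `dataB9_quad_eq_deltaK_of_Δa`: the three
nonsingularities discharged from (3.111); `K`, `C` symmetric; `NS` a kernel basis of the double constraint).
[cite: Balaban1987RG1, (2.11) p.267] [cite: Balaban1985BackgroundPropagators, (3.156) p.428, (3.111) p.417] -/
theorem dataB9_quad_eq_deltaK_add_gMat_of_Δa [Fintype σ] [DecidableEq σ] (eS : b ≃ σ ⊕ (q ⊕ τ)) (e : n ≃ τ ⊕ m)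
    (K C : Matrix b b ℝ) (hK : Kᵀ = K) (hC : Cᵀ = C) (Δ : Matrix n n ℝ) (Q : Matrix m n ℝ) (a : ℝ)
    (hΔ : Δ.IsSymm) (hΔ' : IsUnit (B9H163.Δ' Δ Q a)) (N : Matrix n τ ℝ) (hQN : Q * N = 0)
    (hQM : IsUnit (Q * Qᵀ).det) (hTs : IsUnit (Nᵀ * (Δ * Δ) * N).det) (D : Matrix b n ℝ) (hD : Dᵀ * D = Δ)
    (Qb : Matrix q b ℝ) (Dbar : Matrix q m ℝ) (h115 : Qb * D = Dbar * Q) (ab : ℝ)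
    (hQbM : IsUnit (Qb * Qbᵀ).det)
    (hΔa : (K - (2 : ℝ) • C + D * B9H163.R Δ Q a * Dᵀ + ab • (Qbᵀ * Qb)).PosDef) (NS : Matrix b σ ℝ)
    (hSN : dcon Δ N D Qb * NS = 0) (hNSA : IsUnit (NSᵀ * NS).det) (Δ1 : Matrix b b ℝ)
    (h79 : ∀ A' : b → ℝ, B9H163.R Δ Q a *ᵥ (Dᵀ *ᵥ A') = 0 →
      A' ⬝ᵥ Δ1 *ᵥ A' = A' ⬝ᵥ K *ᵥ A' - 2 * (A' ⬝ᵥ C *ᵥ A'))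
    (hop : X →ₗ[ℝ] (q → ℝ)) (C₂ : (q → ℝ) →ₗ[ℝ] (q → ℝ) →ₗ[ℝ] X) (pairJ : (b → ℝ) →ₗ[ℝ] ℝ)
    (G₂ : (q → ℝ) →ₗ[ℝ] (q → ℝ) →ₗ[ℝ] ℝ) (B : q → ℝ) :
    (dataB9 K C Δ N D Qb Δ1 hop C₂ pairJ G₂).quad B =
      B ⬝ᵥ (B10Eq54QuadForm.deltaK K C Δ Q a D Qb ab (jMatrix (dataB9 K C Δ N D Qb Δ1 hop C₂ pairJ G₂))
        + gMat (dataB9 K C Δ N D Qb Δ1 hop C₂ pairJ G₂)) *ᵥ B := by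
  rw [dataB9_quad_eq_deltaK_of_Δa eS e K C hK hC Δ Q a hΔ hΔ' N hQN hQM hTs D hD Qb Dbar h115 ab hQbM hΔa NS hSN
    hNSA Δ1 h79, add_mulVec, dotProduct_add, gMat_form]
  rfl

/-- **THE DISPLAY (2.11) ON THE ASSEMBLED INSTANCE**: p07's `terms211` (`⟨H₁hC̃^{(2)}(B′), J⟩ − ½G^{(2)}(B′) −
½⟨H₁B′, Δ₁H₁B′⟩`, the row's decl WITH BODY) `= −½⟨B′, (Δ_k + G₂)B′⟩`, `Δ_k` := (3.156) [13] — «The quadratic form in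
B′ above is equal to −½⟨B′, Δ^{(k)}B′⟩, see the definition (3.156) [13] with the δ-function gauge fixing term
replaced by the exponential one» (p07's `terms211_eq_neg_half_quad` + §2). Hypotheses = those of `eq54_of79`.
[cite: Balaban1987RG1, (2.11) p.267] [cite: Balaban1985BackgroundPropagators, (3.156) p.428] -/
theorem terms211_dataB9 (e : n ≃ τ ⊕ m) (K C : Matrix b b ℝ) (Δ : Matrix n n ℝ) (Q : Matrix m n ℝ) (a : ℝ)
    (hΔ : Δ.IsSymm) (hΔ' : IsUnit (B9H163.Δ' Δ Q a)) (N : Matrix n τ ℝ) (hQN : Q * N = 0)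
    (hQM : IsUnit (Q * Qᵀ).det) (hTs : IsUnit (Nᵀ * (Δ * Δ) * N).det) (D : Matrix b n ℝ) (hD : Dᵀ * D = Δ)
    (Qb : Matrix q b ℝ) (Dbar : Matrix q m ℝ) (h115 : Qb * D = Dbar * Q) (ab : ℝ)
    (hW : IsUnit (kkt (K - (2 : ℝ) • C) (dcon Δ N D Qb)).det) (hG : IsUnit (G1inv K C Δ Q a D Qb ab).det)
    (hP : IsUnit (Qb * (G1inv K C Δ Q a D Qb ab)⁻¹ * Qbᵀ).det) (Δ1 : Matrix b b ℝ)
    (h79 : ∀ A' : b → ℝ, B9H163.R Δ Q a *ᵥ (Dᵀ *ᵥ A') = 0 →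
      A' ⬝ᵥ Δ1 *ᵥ A' = A' ⬝ᵥ K *ᵥ A' - 2 * (A' ⬝ᵥ C *ᵥ A'))
    (hop : X →ₗ[ℝ] (q → ℝ)) (C₂ : (q → ℝ) →ₗ[ℝ] (q → ℝ) →ₗ[ℝ] X) (pairJ : (b → ℝ) →ₗ[ℝ] ℝ)
    (G₂ : (q → ℝ) →ₗ[ℝ] (q → ℝ) →ₗ[ℝ] ℝ) (B' : q → ℝ) :
    terms211 (dataB9 K C Δ N D Qb Δ1 hop C₂ pairJ G₂) B' =
      -(1 / 2 : ℝ) * (B' ⬝ᵥ (B10Eq54QuadForm.deltaK K C Δ Q a D Qb ab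
          (jMatrix (dataB9 K C Δ N D Qb Δ1 hop C₂ pairJ G₂)) + gMat (dataB9 K C Δ N D Qb Δ1 hop C₂ pairJ G₂)) *ᵥ B') := by
  rw [terms211_eq_neg_half_quad,
    dataB9_quad_eq_deltaK_add_gMat e K C Δ Q a hΔ hΔ' N hQN hQM hTs D hD Qb Dbar h115 ab hW hG hP Δ1 h79]

/-- **(2.11) `= −½⟨B′, (Δ_k + G₂)B′⟩` ON THE INSTANCE FROM `Δ_a > 0` ALONE, at print's `Δ₁ = delta1`** (the [7] (79)
operator; (79) supplied by `B10Eq54QuadForm.eq79_gaugeFixed`). [cite: Balaban1987RG1, (2.11) p.267]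
[cite: Balaban1985BackgroundPropagators, (3.156) p.428, (3.111) p.417] -/
theorem terms211_dataB9_of_Δa [Fintype σ] [DecidableEq σ] (eS : b ≃ σ ⊕ (q ⊕ τ)) (e : n ≃ τ ⊕ m)
    (K C : Matrix b b ℝ) (hK : Kᵀ = K) (hC : Cᵀ = C) (Δ : Matrix n n ℝ) (Q : Matrix m n ℝ) (a : ℝ)
    (hΔ : Δ.IsSymm) (hΔ' : IsUnit (B9H163.Δ' Δ Q a)) (N : Matrix n τ ℝ) (hQN : Q * N = 0)
    (hQM : IsUnit (Q * Qᵀ).det) (hTs : IsUnit (Nᵀ * (Δ * Δ) * N).det) (D : Matrix b n ℝ) (hD : Dᵀ * D = Δ)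
    (Qb : Matrix q b ℝ) (Dbar : Matrix q m ℝ) (h115 : Qb * D = Dbar * Q) (ab : ℝ)
    (hQbM : IsUnit (Qb * Qbᵀ).det)
    (hΔa : (K - (2 : ℝ) • C + D * B9H163.R Δ Q a * Dᵀ + ab • (Qbᵀ * Qb)).PosDef) (NS : Matrix b σ ℝ)
    (hSN : dcon Δ N D Qb * NS = 0) (hNSA : IsUnit (NSᵀ * NS).det) (hop : X →ₗ[ℝ] (q → ℝ))
    (C₂ : (q → ℝ) →ₗ[ℝ] (q → ℝ) →ₗ[ℝ] X) (pairJ : (b → ℝ) →ₗ[ℝ] ℝ) (G₂ : (q → ℝ) →ₗ[ℝ] (q → ℝ) →ₗ[ℝ] ℝ)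
    (B' : q → ℝ) :
    terms211 (dataB9 K C Δ N D Qb (delta1 K C Δ Q a D) hop C₂ pairJ G₂) B' =
      -(1 / 2 : ℝ) * (B' ⬝ᵥ (B10Eq54QuadForm.deltaK K C Δ Q a D Qb ab
            (jMatrix (dataB9 K C Δ N D Qb (delta1 K C Δ Q a D) hop C₂ pairJ G₂))
          + gMat (dataB9 K C Δ N D Qb (delta1 K C Δ Q a D) hop C₂ pairJ G₂)) *ᵥ B') := by
  rw [terms211_eq_neg_half_quad,
    dataB9_quad_eq_deltaK_add_gMat_of_Δa eS e K C hK hC Δ Q a hΔ hΔ' N hQN hQM hTs D hD Qb Dbar h115 ab hQbM hΔa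
      NS hSN hNSA (delta1 K C Δ Q a D) (B10Eq54QuadForm.eq79_gaugeFixed K C Δ Q a D)]

omit [DecidableEq q] in
/-- **THE p. 267 BOOKKEEPING CHAIN AT ONE OPERATOR**: for any (2.10) setting whose (1.5) datum has
`⟨B, Δ^{(k)}B⟩ = ⟨B, ΔkB⟩` (the instance: `Δk = Δ_k + G₂`, §2), on the constraint surface `Q̃B′ = 0` the bracket of
(2.10) after `B′ = B − hD̃(B)` and `B = g_kB′` reads `−g_k⁻²A(U_{k+1}) − ½⟨B′, ΔkB′⟩ + g_k·rest + E_k(…)` — p07's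
`Setting.bracket210_onConstraint_quad` («the only term with a negative power of g_k is the action evaluated at the
configuration U_{k+1}. Terms of the order 0 in g_k are (2.11)») with the order-0 term at the matrix `Δk`.
[cite: Balaban1987RG1, (2.10)-(2.11) p.267] -/
theorem bracket210_onConstraint_of_quad {W : Type*} [AddCommGroup W] [Module ℝ W]
    (S : B12Eq210Scaling.Setting ℝ (q → ℝ) W X) (Δk : Matrix q q ℝ) (hquad : ∀ B : q → ℝ, S.D.quad B = B ⬝ᵥ Δk *ᵥ B)
    {g : ℝ} (hg : g ≠ 0) (RD : (q → ℝ) → X) (RG : (q → ℝ) → ℝ) (RV : W → ℝ)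
    (hDt : ∀ B : q → ℝ, S.Dt (g • B) = g ^ 2 • S.D.Ctwo B + g ^ 3 • RD B)
    (hG₃ : ∀ Y : q → ℝ, S.G₃ (g • Y) = g ^ 3 * RG Y) (hV : ∀ A' : W, S.Vpot (g • A') = g ^ 3 * RV A')
    (LQ : (q → ℝ) →ₗ[ℝ] X) (Qk : W →ₗ[ℝ] (q → ℝ)) (hQH : ∀ B : q → ℝ, Qk (S.D.H B) = B)
    (hJ : ∀ a' : W, LQ (Qk a') = 0 → S.D.pairJ a' = 0) {B' : q → ℝ} (hB' : LQ B' = 0) :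
    S.bracket210 g (S.oldVar g B') =
      -(1 / g ^ 2) * S.A - (1 / 2 : ℝ) * (B' ⬝ᵥ Δk *ᵥ B') + g * S.rest g RD RG RV B' + S.Ek (S.oldVar g B') := by
  rw [S.bracket210_onConstraint_quad hg RD RG RV hDt hG₃ hV LQ Qk hQH hJ hB', hquad]

end Instance

/-! ## §3  Uniqueness: `Δ^{(k)}` is THE symmetric operator `Δ_k + G₂` -/

section Symmetric

variable {q : Type*} [Fintype q] [DecidableEq q]

/-- Polarization: a symmetric real matrix with zero quadratic form is zero. [folklore] -/
private theorem eq_zero_of_transpose_eq_of_quadForm_eq_zero (M : Matrix q q ℝ) (hM : Mᵀ = M)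
    (h0 : ∀ v : q → ℝ, v ⬝ᵥ M *ᵥ v = 0) : M = 0 := by
  have hsymm : ∀ v w : q → ℝ, w ⬝ᵥ M *ᵥ v = v ⬝ᵥ M *ᵥ w := by
    intro v w
    rw [← hM, mulVec_transpose, dotProduct_comm, ← dotProduct_mulVec, hM]
  have hpol : ∀ v w : q → ℝ, v ⬝ᵥ M *ᵥ w = 0 := by
    intro v w
    have h := h0 (v + w)
    rw [mulVec_add, dotProduct_add, add_dotProduct, add_dotProduct, h0 v, h0 w, hsymm v w] at h
    linarith
  ext i j
  have h := hpol (Pi.single i 1) (Pi.single j 1)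
  rw [mulVec_single_one, single_one_dotProduct] at h
  exact h

/-- Two symmetric real matrices with the same quadratic form are equal. [folklore] -/
private theorem eq_of_transpose_eq_of_quadForm_eq (S S' : Matrix q q ℝ) (hS : Sᵀ = S) (hS' : S'ᵀ = S')
    (h : ∀ v : q → ℝ, v ⬝ᵥ S *ᵥ v = v ⬝ᵥ S' *ᵥ v) : S = S' :=
  sub_eq_zero.mp <| eq_zero_of_transpose_eq_of_quadForm_eq_zero (S - S') (by rw [transpose_sub, hS, hS'])
    fun v => by rw [sub_mulVec, dotProduct_sub, h v, sub_self]

variable {n m τ b σ : Type*} [Fintype n] [Fintype m] [Fintype τ] [Fintype b] [DecidableEq n] [DecidableEq m]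
  [DecidableEq τ] [DecidableEq b] {W X : Type*} [AddCommGroup W] [Module ℝ W] [AddCommGroup X] [Module ℝ X]

/-- `Δ_k + G₂` is symmetric when `K`, `C`, the site Laplacian and `G₂` are (`deltaK_transpose` ∘ `G1inv_transpose`,
`gMat_transpose`). [cite: Balaban1987RG1, (2.11) p.267] [cite: Balaban1985BackgroundPropagators, (3.156) p.428] -/
theorem deltaK_add_gMat_transpose (K C : Matrix b b ℝ) (hK : Kᵀ = K) (hC : Cᵀ = C) (Δ : Matrix n n ℝ)
    (Q : Matrix m n ℝ) (a : ℝ) (hΔ : Δ.IsSymm) (D : Matrix b n ℝ) (Qb : Matrix q b ℝ) (ab : ℝ) (E : Matrix q q ℝ)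
    (dat : Data ℝ (q → ℝ) W X) (hG₂ : ∀ x y, dat.G₂ x y = dat.G₂ y x) :
    (B10Eq54QuadForm.deltaK K C Δ Q a D Qb ab E + gMat dat)ᵀ = B10Eq54QuadForm.deltaK K C Δ Q a D Qb ab E + gMat dat := by
  rw [transpose_add, deltaK_transpose K C Δ Q a D Qb ab E (G1inv_transpose K C hK hC Δ Q a hΔ D Qb ab),
    gMat_transpose dat hG₂]

/-- **`Δ^{(k)}` DETERMINED** (on the assembled instance, with `K`, `C`, `G₂` symmetric and `Δ_a > 0`): every SYMMETRIC
matrix `S` representing the (1.5) form, `⟨B, Δ^{(k)}B⟩ = ⟨B, SB⟩` for all `B`, IS `Δ_k + G₂` — print's «the quadratic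
form in B′ above is equal to −½⟨B′, Δ^{(k)}B′⟩» names ONE operator: the (3.156)-operator of [13] plus the
gauge-fixing Hessian. [cite: Balaban1987RG1, (2.11) p.267] [cite: Balaban1985BackgroundPropagators, (3.156) p.428] -/
theorem eq_deltaK_add_gMat_of_isSymm [Fintype σ] [DecidableEq σ] (eS : b ≃ σ ⊕ (q ⊕ τ)) (e : n ≃ τ ⊕ m)
    (K C : Matrix b b ℝ) (hK : Kᵀ = K) (hC : Cᵀ = C) (Δ : Matrix n n ℝ) (Q : Matrix m n ℝ) (a : ℝ)
    (hΔ : Δ.IsSymm) (hΔ' : IsUnit (B9H163.Δ' Δ Q a)) (N : Matrix n τ ℝ) (hQN : Q * N = 0)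
    (hQM : IsUnit (Q * Qᵀ).det) (hTs : IsUnit (Nᵀ * (Δ * Δ) * N).det) (D : Matrix b n ℝ) (hD : Dᵀ * D = Δ)
    (Qb : Matrix q b ℝ) (Dbar : Matrix q m ℝ) (h115 : Qb * D = Dbar * Q) (ab : ℝ)
    (hQbM : IsUnit (Qb * Qbᵀ).det)
    (hΔa : (K - (2 : ℝ) • C + D * B9H163.R Δ Q a * Dᵀ + ab • (Qbᵀ * Qb)).PosDef) (NS : Matrix b σ ℝ)
    (hSN : dcon Δ N D Qb * NS = 0) (hNSA : IsUnit (NSᵀ * NS).det) (Δ1 : Matrix b b ℝ)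
    (h79 : ∀ A' : b → ℝ, B9H163.R Δ Q a *ᵥ (Dᵀ *ᵥ A') = 0 →
      A' ⬝ᵥ Δ1 *ᵥ A' = A' ⬝ᵥ K *ᵥ A' - 2 * (A' ⬝ᵥ C *ᵥ A'))
    (hop : X →ₗ[ℝ] (q → ℝ)) (C₂ : (q → ℝ) →ₗ[ℝ] (q → ℝ) →ₗ[ℝ] X) (pairJ : (b → ℝ) →ₗ[ℝ] ℝ)
    (G₂ : (q → ℝ) →ₗ[ℝ] (q → ℝ) →ₗ[ℝ] ℝ) (hG₂ : ∀ x y, G₂ x y = G₂ y x) (S : Matrix q q ℝ) (hS : Sᵀ = S)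
    (hform : ∀ B : q → ℝ, (dataB9 K C Δ N D Qb Δ1 hop C₂ pairJ G₂).quad B = B ⬝ᵥ S *ᵥ B) :
    S = B10Eq54QuadForm.deltaK K C Δ Q a D Qb ab (jMatrix (dataB9 K C Δ N D Qb Δ1 hop C₂ pairJ G₂))
          + gMat (dataB9 K C Δ N D Qb Δ1 hop C₂ pairJ G₂) := by
  refine eq_of_transpose_eq_of_quadForm_eq S _ hS
    (deltaK_add_gMat_transpose K C hK hC Δ Q a hΔ D Qb ab _ _ hG₂) fun v => ?_
  rw [← hform v]
  exact dataB9_quad_eq_deltaK_add_gMat_of_Δa eS e K C hK hC Δ Q a hΔ hΔ' N hQN hQM hTs D hD Qb Dbar h115 ab hQbM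
    hΔa NS hSN hNSA Δ1 h79 hop C₂ pairJ G₂ v

end Symmetric

/-! ## §4  Where print consumes `Δ^{(k)}`: `Z^{(k)}(U_{k+1})` by (1.4) with `j = k`, and `C^{(k)} = (C*Δ^{(k)}C)⁻¹` -/

section Consumers

variable {q ρ : Type*} [Fintype q] [Fintype ρ] {W X : Type*} [AddCommGroup W] [Module ℝ W] [AddCommGroup X]
  [Module ℝ X]

/-- (1.4) depends on the matrix `S` only through its quadratic form. [cite: Balaban1987RG1, (1.4) p.260] -/
theorem Z14_congr (S S' : Matrix q q ℝ) (N : Matrix q ρ ℝ) (h : ∀ v : q → ℝ, v ⬝ᵥ S *ᵥ v = v ⬝ᵥ S' *ᵥ v) :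
    Z14 S N = Z14 S' N := by
  simp only [Z14, h]

/-- **«This quadratic form defines the k-th normalization factor Z^{(k)}(U_{k+1}) given by the formula (1.4) with
j = k»**: whenever `⟨B, Δ^{(k)}B⟩ = ⟨B, ΔkB⟩`, p07's (1.4) for the form (1.5) (`B12Eq15QuadraticForm.Z14_form`) reads
`Z^{(k)} = ∫dz exp[−½⟨Nz, Δk·Nz⟩] = Z14 Δk N`. [cite: Balaban1987RG1, (1.4) p.260, (2.11) p.267] -/
theorem Z14_form_eq_of_quad [DecidableEq q] (dat : Data ℝ (q → ℝ) W X) (Δk : Matrix q q ℝ)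
    (hquad : ∀ B : q → ℝ, dat.quad B = B ⬝ᵥ Δk *ᵥ B) (N : Matrix q ρ ℝ) :
    Z14 (LinearMap.toMatrix₂' ℝ dat.form) N = Z14 Δk N := by
  rw [B12Eq15QuadraticForm.Z14_form]
  simp only [Z14, hquad]

variable [DecidableEq q] {n m τ b : Type*} [Fintype n] [Fintype m] [Fintype τ] [Fintype b] [DecidableEq n]
  [DecidableEq m] [DecidableEq τ] [DecidableEq b]

/-- **`Z^{(k)}(U_{k+1})` AT THE DICTIONARY**: for the assembled instance, `Z14 (matrix of Δ^{(k)}) N = Z14 (Δ_k + G₂) N`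
— (1.4) with `j = k` is the Gaussian normalisation of the (3.156)-operator plus the gauge-fixing Hessian, restricted to
`{Q̃B = 0}` by the kernel parametrisation `N`. [cite: Balaban1987RG1, (1.4) p.260, (2.11) p.267]
[cite: Balaban1985BackgroundPropagators, (3.156) p.428] -/
theorem Z14_form_dataB9_eq (e : n ≃ τ ⊕ m) (K C : Matrix b b ℝ) (Δ : Matrix n n ℝ) (Q : Matrix m n ℝ) (a : ℝ)
    (hΔ : Δ.IsSymm) (hΔ' : IsUnit (B9H163.Δ' Δ Q a)) (Nk : Matrix n τ ℝ) (hQN : Q * Nk = 0)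
    (hQM : IsUnit (Q * Qᵀ).det) (hTs : IsUnit (Nkᵀ * (Δ * Δ) * Nk).det) (D : Matrix b n ℝ) (hD : Dᵀ * D = Δ)
    (Qb : Matrix q b ℝ) (Dbar : Matrix q m ℝ) (h115 : Qb * D = Dbar * Q) (ab : ℝ)
    (hW : IsUnit (kkt (K - (2 : ℝ) • C) (dcon Δ Nk D Qb)).det) (hG : IsUnit (G1inv K C Δ Q a D Qb ab).det)
    (hP : IsUnit (Qb * (G1inv K C Δ Q a D Qb ab)⁻¹ * Qbᵀ).det) (Δ1 : Matrix b b ℝ)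
    (h79 : ∀ A' : b → ℝ, B9H163.R Δ Q a *ᵥ (Dᵀ *ᵥ A') = 0 →
      A' ⬝ᵥ Δ1 *ᵥ A' = A' ⬝ᵥ K *ᵥ A' - 2 * (A' ⬝ᵥ C *ᵥ A'))
    (hop : X →ₗ[ℝ] (q → ℝ)) (C₂ : (q → ℝ) →ₗ[ℝ] (q → ℝ) →ₗ[ℝ] X) (pairJ : (b → ℝ) →ₗ[ℝ] ℝ)
    (G₂ : (q → ℝ) →ₗ[ℝ] (q → ℝ) →ₗ[ℝ] ℝ) (N : Matrix q ρ ℝ) :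
    Z14 (LinearMap.toMatrix₂' ℝ (dataB9 K C Δ Nk D Qb Δ1 hop C₂ pairJ G₂).form) N =
      Z14 (B10Eq54QuadForm.deltaK K C Δ Q a D Qb ab (jMatrix (dataB9 K C Δ Nk D Qb Δ1 hop C₂ pairJ G₂))
        + gMat (dataB9 K C Δ Nk D Qb Δ1 hop C₂ pairJ G₂)) N :=
  Z14_form_eq_of_quad _ _
    (dataB9_quad_eq_deltaK_add_gMat e K C Δ Q a hΔ hΔ' Nk hQN hQM hTs D hD Qb Dbar h115 ab hW hG hP Δ1 h79 hop C₂
      pairJ G₂) N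

/-- **«B′ = CB» IN THE FORM, AT THE DICTIONARY**: r20's precision `prec212 C Δk = CᵀΔkC` at `Δk = Δ_k + G₂` has the
quadratic form `⟨B, (CᵀΔ^{(k)}C)B⟩ = ⟨CB, Δ^{(k)}(CB)⟩ = ⟨B′, Δ^{(k)}B′⟩|_{B′ = CB}` of the assembled (1.5) datum —
«the quadratic form defines also a Gaussian measure … Denoting the remaining variables by B we have B′ = CB».
(`Cop` = print's `C`; `Y`, `U` = r20's background slot, constant here.) [cite: Balaban1987RG1, (2.11)-(2.12) p.268] -/
theorem quadForm_prec212_eq_quad_dataB9 {κ : Type*} [Fintype κ] {Y : Type*} (e : n ≃ τ ⊕ m) (K C : Matrix b b ℝ)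
    (Δ : Matrix n n ℝ) (Q : Matrix m n ℝ) (a : ℝ) (hΔ : Δ.IsSymm) (hΔ' : IsUnit (B9H163.Δ' Δ Q a))
    (Nk : Matrix n τ ℝ) (hQN : Q * Nk = 0) (hQM : IsUnit (Q * Qᵀ).det) (hTs : IsUnit (Nkᵀ * (Δ * Δ) * Nk).det)
    (D : Matrix b n ℝ) (hD : Dᵀ * D = Δ) (Qb : Matrix q b ℝ) (Dbar : Matrix q m ℝ) (h115 : Qb * D = Dbar * Q)
    (ab : ℝ) (hW : IsUnit (kkt (K - (2 : ℝ) • C) (dcon Δ Nk D Qb)).det)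
    (hG : IsUnit (G1inv K C Δ Q a D Qb ab).det) (hP : IsUnit (Qb * (G1inv K C Δ Q a D Qb ab)⁻¹ * Qbᵀ).det)
    (Δ1 : Matrix b b ℝ)
    (h79 : ∀ A' : b → ℝ, B9H163.R Δ Q a *ᵥ (Dᵀ *ᵥ A') = 0 →
      A' ⬝ᵥ Δ1 *ᵥ A' = A' ⬝ᵥ K *ᵥ A' - 2 * (A' ⬝ᵥ C *ᵥ A'))
    (hop : X →ₗ[ℝ] (q → ℝ)) (C₂ : (q → ℝ) →ₗ[ℝ] (q → ℝ) →ₗ[ℝ] X) (pairJ : (b → ℝ) →ₗ[ℝ] ℝ)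
    (G₂ : (q → ℝ) →ₗ[ℝ] (q → ℝ) →ₗ[ℝ] ℝ) (Cop : Matrix q κ ℝ) (U : Y) (B : κ → ℝ) :
    B ⬝ᵥ (B12Eq213Body268.prec212 Cop
        (fun _ : Y => B10Eq54QuadForm.deltaK K C Δ Q a D Qb ab (jMatrix (dataB9 K C Δ Nk D Qb Δ1 hop C₂ pairJ G₂))
          + gMat (dataB9 K C Δ Nk D Qb Δ1 hop C₂ pairJ G₂)) U *ᵥ B)
      = (dataB9 K C Δ Nk D Qb Δ1 hop C₂ pairJ G₂).quad (Cop *ᵥ B) := by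
  rw [B12Eq213Body268.quadForm_prec212,
    dataB9_quad_eq_deltaK_add_gMat e K C Δ Q a hΔ hΔ' Nk hQN hQM hTs D hD Qb Dbar h115 ab hW hG hP Δ1 h79 hop C₂
      pairJ G₂, dotProduct_mulVec]

/-- **«the covariance C^{(k)} = C^{(k)}(U_{k+1}) = (C*Δ^{(k)}C)⁻¹»**: under the tree's normalised Gaussian
`B2Eq228Conditioning.gaussProb` at r20's precision `prec212 C Δk = CᵀΔkC` (positive definite: hypothesis `hpd`, cf.
`B12Eq213Body268.posDef_prec212`) the coordinates of the remaining variables `B` have covariance `(CᵀΔkC)⁻¹` — r20's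
`covariance_gaussProb` at the (2.11) precision; with `Δk = Δ_k + G₂` (§2) this is print's `C^{(k)}` for the operator of
(2.11). [cite: Balaban1987RG1, (2.11)-(2.12) p.268] -/
theorem covariance_gaussProb_prec212 {ι : Type*} {κ : Type} [Fintype ι] [Fintype κ] [DecidableEq κ] {Y : Type*}
    (Cop : Matrix ι κ ℝ) (Δk : Matrix ι ι ℝ) (U : Y)
    (hpd : (B12Eq213Body268.prec212 Cop (fun _ : Y => Δk) U).PosDef) (i j : κ) :
    ProbabilityTheory.covariance (fun B : κ → ℝ => B i) (fun B => B j)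
        (B2Eq228Conditioning.gaussProb (B12Eq213Body268.prec212 Cop (fun _ : Y => Δk) U))
      = (Copᵀ * Δk * Cop)⁻¹ i j := by
  rw [B12Eq213Body268.covariance_gaussProb hpd, B12Eq213Body268.prec212_def]

end Consumers

end

end Literature.MathematicalPhysics.QuantumFieldTheory.Balaban1983to89.B12Eq211Operator267
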